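import Mathlib
import Summits.ValiantsHypothesis.ValiantsHypothesis.Theorems.FifoMatchingNNDivisionHardBinomialPowers
import HarnessLib

/-!
# Route FifoMatching — crux `NNDivisionHard` (stmt-ValiantsHypothesis-21181): cofactors GENERIC FOR A SHORT ARC SET are not
# certificates — `top_{𝟙_{I^c}} h` a monomial for some set `I` of short arcs ⇒ `2^((log₂ n + c)^c) < L₊(NN_n · h) + L₊(h)`

`…ArcElimination.lean`: if the outer `I`-face `top_{𝟙_{I^c}} h` of a cofactor is a single monomial then the certificate
computes the `I`-avoiding face `NN_n^{¬I}` at polynomial cost (`complexity_avoidingFace_le_of_top_monomial`).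
`…BinomialPowers.lean` proved the single SHORT arc face hard.  Here both are run for an ARBITRARY set `I` of short arcs
(`(j − i)³ ≤ n²`; any size): the long-arc thick-queue measure avoids every short arc at once.

* `shift_avoids_short` — the shift matching `i ↦ i ± n` avoids every short arc (`n ≥ 2`);
* ★★ `shortFaces_exp_lower_bound` — **eventually in `n`: `2^{n^{1/6}} ≤ L₊(NN_n^{¬I}) + 1` for EVERY set `I` of short arcs**;
* ★★ `shortGeneric_exp_lower_bound` / `shortGeneric_not_certificate_qp` — **for every `c`, eventually in `n`: every cofactor
  `h` whose outer face `top_{𝟙_{I^c}} h` is a single monomial, for SOME set `I` of short arcs, satisfies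
  `2^((log₂ n + c)^c) < L₊(NN_n · h) + L₊(h)`** — a GENERICITY tier in a new direction: not a vertex / prefix / adjacent-arc
  weight but the indicator of the complement of an arbitrary short arc set, with NO transport to a smaller `NN_b` (the face
  `NN_n^{¬I}` itself is hard);
* `weight_compl_lt_of_meets` — a monomial of degree `≤ n` using an arc of `I` has `𝟙_{I^c}`-weight `< n`;
* ★★ `powerSum_not_certificate_qp` — instance: **`h = (c₀·x^{M₀} + q)^D`** with `M₀` a nest-free perfect matching avoiding the
  short arc set `I`, `c₀ ≠ 0`, and `q` any nonnegative polynomial all of whose monomials have degree `≤ n` and use an arc of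
  `I` — e.g. every positive power sum `(Σ_{M ∈ 𝓜} c_M x^M)^D` of perfect matchings one of which is nest-free and differs from
  each other one at a short arc of the latter — is not a certificate, for EVERY `D`.

HONEST FRAMING: a genericity tier for ONE candidate family; cofactors whose outer faces are never monomials for short arc
sets (e.g. `NN_n`-symmetric sums) are untouched; stmt-21181 stays OPEN; nothing here bears on `NNNotVP` or on VP ≠ VNP
(NOT proved).  No definitions, no named facts.
References: Hrubeš–Yehudayoff 2021 §6 Problem 2 [HrubesYehudayoff2021]; Jukna–Seiwert–Sergeev 2022 Thm 1
[JuknaSeiwertSergeev2022]; Bürgisser 2000 Rem. 2.7 [Burgisser2000].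
-/

noncomputable section

-- Sub = Summit single-conjunct layout: the duplicated namespace component is mandated by the tree.
set_option linter.dupNamespace false
set_option autoImplicit false

namespace Summit.ValiantsHypothesis.ValiantsHypothesis.Theorems.FifoMatching.NNDivisionHard.ShortArcGeneric

open Finset MvPolynomial Literature.Computability.AlgebraicComplexity
open Summit.ValiantsHypothesis.ValiantsHypothesis.Theorems.ZeroOneTransfer.Negative
  (topComponent topComponent_mul)
open Summit.ValiantsHypothesis.ValiantsHypothesis.Theorems.FifoMatching.NNDivisionHard.LocalCofactor
  (weight_le weight_eq_iff shiftMatching_avoids_short)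
open Summit.ValiantsHypothesis.ValiantsHypothesis.Theorems.FifoMatching.NNDivisionHard.StackPowersQueue
  (shiftMatching shiftMatching_mem)
open Summit.ValiantsHypothesis.ValiantsHypothesis.Theorems.FifoMatching.NNDivisionHard.ArcElimination
  (complexity_avoidingFace_le_of_top_monomial topComponent_add_eq_left_of_lt)
open Summit.ValiantsHypothesis.ValiantsHypothesis.Theorems.FifoMatching.NNDivisionHard.BinomialPowers
  (support_arcAvoidingFace_subset arcExponent_mem_support_arcAvoidingFace absorb_arith absorb_exp)
open Summit.ValiantsHypothesis.ValiantsHypothesis.Theorems.FifoMatching.NNDivisionHard.SupportBetween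
  (one_le_complexity_mul_of_spread_of_support_between)
open Summit.ValiantsHypothesis.ValiantsHypothesis.Theorems.FifoMatching.NNDivisionHard.LongSpreadLaw
  (exp_lower_bound_of_longSpreadLaw)
open scoped NNReal BigOperators

variable {n : ℕ}

/-! ### §1 Every short arc set is avoidable, and its avoiding face is hard -/

/-- The shift matching `i ↦ i ± n` (all arcs of length `n`) avoids every set of short arcs (`(j − i)³ ≤ n²`, `n ≥ 2`).
[folklore] -/
theorem shift_avoids_short (hn : 2 ≤ n) {I : Finset (Fin (2 * n) × Fin (2 * n))}
    (hI : ∀ e ∈ I, ((e.2 : ℕ) - (e.1 : ℕ)) ^ 3 ≤ n ^ 2) :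
    ∀ i ∈ openers (shiftMatching n), (i, shiftMatching n i) ∉ I := by
  intro i hi hmem
  have h := shiftMatching_avoids_short (n := n) (ℓ₀ := n) le_rfl i hi
  rw [Finset.mem_filter, not_and] at h
  have hlt : n ^ 2 < n ^ 3 := Nat.pow_lt_pow_right (by omega) (by norm_num)
  have h1 : ((shiftMatching n i : ℕ) - (i : ℕ)) ^ 3 < n ^ 3 := lt_of_le_of_lt (hI _ hmem) hlt
  have h2 : (shiftMatching n i : ℕ) - (i : ℕ) < n := (Nat.pow_lt_pow_iff_left (by norm_num)).1 h1
  have h' := h (Finset.mem_univ _)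
  simp only at h'
  omega

/-- ★★ **EVERY SHORT-ARC-SET-AVOIDING FACE IS HARD.**  Eventually in `n`: for every set `I` of arc variables `(i, j)` with
`(j − i)³ ≤ n²`, `2^{n^{1/6}} ≤ L₊(NN_n^{¬I}) + 1` (the long-arc thick-queue measure lives inside the support of the face).
[cite: HrubesYehudayoff2021, §6 Problem 2] -/
theorem shortFaces_exp_lower_bound : ∃ n₀ : ℕ, ∀ n : ℕ, n₀ ≤ n → ∀ I : Finset (Fin (2 * n) × Fin (2 * n)),
    (∀ e ∈ I, ((e.2 : ℕ) - (e.1 : ℕ)) ^ 3 ≤ n ^ 2) →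
      (2 : ℝ) ^ ((n : ℝ) ^ ((1 : ℝ) / 6)) ≤
        ((complexity (∑ M ∈ (nestFreeMatchings (2 * n)).filter (fun M => ∀ j ∈ openers M, (j, M j) ∉ I),
          arcMonomial ℝ≥0 M) + 1 : ℕ) : ℝ) := by
  classical
  let good : (n : ℕ) → Set ℕ := fun n => {L | ∃ I : Finset (Fin (2 * n) × Fin (2 * n)),
    (∀ e ∈ I, ((e.2 : ℕ) - (e.1 : ℕ)) ^ 3 ≤ n ^ 2) ∧
    L = complexity (∑ M ∈ (nestFreeMatchings (2 * n)).filter (fun M => ∀ j ∈ openers M, (j, M j) ∉ I),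
          arcMonomial ℝ≥0 M) + 1}
  set F : ℕ → ℕ := fun n => sInf (good n) with hF
  have hmem : ∀ n, F n ∈ good n := fun n =>
    Nat.sInf_mem ⟨_, ⟨∅, fun e he => absurd he (Finset.notMem_empty e), rfl⟩⟩
  obtain ⟨n₀, hn₀⟩ := exp_lower_bound_of_longSpreadLaw F (fun n hn ℓ₀ hℓ3 hℓn β μ hμ hμlong hS => by
    obtain ⟨I, hI, hL⟩ := hmem n
    rw [hL]
    have havoid : ∀ M ∈ nestFreeMatchings (2 * n), μ M ≠ 0 → ∀ j ∈ openers M, (j, M j) ∉ I := by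
      intro M hM hμM j hj hje
      have hlong := hμlong M hM hμM j hj
      have hshort := hI _ hje
      have h1 : (((M j : ℕ) - (j : ℕ)) ^ 3) < ℓ₀ ^ 3 := lt_of_le_of_lt hshort hℓ3
      have h2 : (M j : ℕ) - (j : ℕ) < ℓ₀ := (Nat.pow_lt_pow_iff_left (by norm_num)).1 h1
      omega
    have hone := one_le_complexity_mul_of_spread_of_support_between hn (support_arcAvoidingFace_subset I) μ hμ
      (fun M hM hμM => arcExponent_mem_support_arcAvoidingFace I hM (havoid M hM hμM)) hS
    set G := complexity (∑ M ∈ (nestFreeMatchings (2 * n)).filter (fun M => ∀ j ∈ openers M, (j, M j) ∉ I),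
        arcMonomial ℝ≥0 M) with hG
    calc (1 : ℝ) ≤ 4 * (G : ℝ) * ((n : ℝ) + 1) ^ 2 * (β : ℝ) := hone
      _ ≤ 4 * ((G + 1 : ℕ) : ℝ) * ((n : ℝ) + 1) ^ 2 * (β : ℝ) := by gcongr; exact_mod_cast Nat.le_succ G)
  refine ⟨n₀, fun n hn I hI => ?_⟩
  have hle : F n ≤ complexity (∑ M ∈ (nestFreeMatchings (2 * n)).filter (fun M => ∀ j ∈ openers M,
        (j, M j) ∉ I), arcMonomial ℝ≥0 M) + 1 := Nat.sInf_le ⟨I, hI, rfl⟩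
  exact (hn₀ n hn).trans (by exact_mod_cast hle)

/-! ### §2 Short-arc-generic cofactors -/

/-- ★★ **SHORT-ARC-GENERIC COFACTORS, stretched-exponential form.**  Eventually in `n`: for every set `I` of short arcs
(`(j − i)³ ≤ n²`) and every cofactor `h` whose outer face `top_{𝟙_{I^c}} h` is a single monomial `c · x^d` (`c ≠ 0`),
`2^{n^{1/6}} ≤ 16 ((2n+1) (L₊(NN_n · h) + 2))² + 1`. [cite: HrubesYehudayoff2021, §6 Problem 2]
[cite: JuknaSeiwertSergeev2022, Thm 1] -/
theorem shortGeneric_exp_lower_bound : ∃ n₀ : ℕ, ∀ n : ℕ, n₀ ≤ n → ∀ I : Finset (Fin (2 * n) × Fin (2 * n)),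
    (∀ e ∈ I, ((e.2 : ℕ) - (e.1 : ℕ)) ^ 3 ≤ n ^ 2) →
    ∀ (h : MvPolynomial (Fin (2 * n) × Fin (2 * n)) ℝ≥0) (d : (Fin (2 * n) × Fin (2 * n)) →₀ ℕ) (c : ℝ≥0), c ≠ 0 →
      topComponent (fun e : Fin (2 * n) × Fin (2 * n) => if e ∈ I then 0 else 1) h = monomial d c →
      (2 : ℝ) ^ ((n : ℝ) ^ ((1 : ℝ) / 6)) ≤
        ((16 * ((2 * n + 1) * (complexity (nestFreeMatchingPoly n ℝ≥0 * h) + 2)) ^ 2 + 1 : ℕ) : ℝ) := by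
  obtain ⟨n₀, hn₀⟩ := shortFaces_exp_lower_bound
  refine ⟨max n₀ 2, fun n hn I hI h d c hc htop => ?_⟩
  have hn0 : n₀ ≤ n := le_trans (le_max_left _ _) hn
  have hn2 : 2 ≤ n := le_trans (le_max_right _ _) hn
  have hIav : ∃ M ∈ nestFreeMatchings (2 * n), ∀ j ∈ openers M, (j, M j) ∉ I :=
    ⟨shiftMatching n, shiftMatching_mem n, shift_avoids_short hn2 hI⟩
  have h1 := hn₀ n hn0 I hI
  have h2 := complexity_avoidingFace_le_of_top_monomial I hIav hc htop
  refine h1.trans ?_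
  exact_mod_cast Nat.add_le_add_right h2 1

/-- ★★ **SHORT-ARC-GENERIC COFACTORS ARE NOT CERTIFICATES (currency of stmt-21181).**  For every `c`, eventually in `n`:
for every set `I` of short arcs and every cofactor `h` whose outer face `top_{𝟙_{I^c}} h` is a single monomial,
`2^((log₂ n + c)^c) < L₊(NN_n · h) + L₊(h)`. [cite: HrubesYehudayoff2021, §6 Problem 2] -/
theorem shortGeneric_not_certificate_qp (c : ℕ) : ∃ n₀ : ℕ, ∀ n : ℕ, n₀ ≤ n →
    ∀ I : Finset (Fin (2 * n) × Fin (2 * n)), (∀ e ∈ I, ((e.2 : ℕ) - (e.1 : ℕ)) ^ 3 ≤ n ^ 2) →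
    ∀ (h : MvPolynomial (Fin (2 * n) × Fin (2 * n)) ℝ≥0) (d : (Fin (2 * n) × Fin (2 * n)) →₀ ℕ) (a : ℝ≥0), a ≠ 0 →
      topComponent (fun e : Fin (2 * n) × Fin (2 * n) => if e ∈ I then 0 else 1) h = monomial d a →
      2 ^ ((Nat.log 2 n + c) ^ c) < complexity (nestFreeMatchingPoly n ℝ≥0 * h) + complexity h := by
  obtain ⟨n₁, hn₁⟩ := shortGeneric_exp_lower_bound
  set K : ℕ := c + 14 with hK
  obtain ⟨n₂, hn₂⟩ := CorSandwich.polylog_lt_rpow_eventually K (c := 1 / 6) (by norm_num)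
  refine ⟨max n₁ n₂, fun n hn I hI h d a ha htop => ?_⟩
  have hn1 : n₁ ≤ n := le_trans (le_max_left _ _) hn
  have hn2 : n₂ ≤ n := le_trans (le_max_right _ _) hn
  set L := complexity (nestFreeMatchingPoly n ℝ≥0 * h) with hL
  by_contra hle
  push Not at hle
  have hb1 : L ≤ 2 ^ ((Nat.log 2 n + c) ^ c) := le_trans (Nat.le_add_right _ _) hle
  have h1 := hn₁ n hn1 I hI h d a ha htop
  have h2 := hn₂ n hn2
  have h3 : (2 : ℝ) ^ ((((Nat.log 2 n + K) ^ K : ℕ) : ℝ)) < (2 : ℝ) ^ ((n : ℝ) ^ ((1 : ℝ) / 6)) :=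
    Real.rpow_lt_rpow_of_exponent_lt (by norm_num) h2
  have h4 : ((2 ^ ((Nat.log 2 n + K) ^ K) : ℕ) : ℝ) < ((16 * ((2 * n + 1) * (L + 2)) ^ 2 + 1 : ℕ) : ℝ) := by
    rw [Nat.cast_pow, Nat.cast_ofNat, ← Real.rpow_natCast]
    exact h3.trans_le h1
  have h5 : 2 ^ ((Nat.log 2 n + K) ^ K) < 16 * ((2 * n + 1) * (L + 2)) ^ 2 + 1 := by exact_mod_cast h4
  have e1 := absorb_arith n c L hb1
  have e3 : 2 ^ (2 * (Nat.log 2 n + c) ^ c + 2 * Nat.log 2 n + 13) ≤ 2 ^ ((Nat.log 2 n + K) ^ K) :=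
    Nat.pow_le_pow_right (by norm_num) (absorb_exp (Nat.log 2 n) c)
  exact absurd (lt_of_lt_of_le h5 (e1.trans e3)) (lt_irrefl _)

/-! ### §3 Instance: power sums led by a nest-free matching -/

/-- A monomial of degree `≤ n` using an arc of `I` has `𝟙_{I^c}`-weight `< n`. [folklore] -/
theorem weight_compl_lt_of_meets {I : Finset (Fin (2 * n) × Fin (2 * n))} {d : (Fin (2 * n) × Fin (2 * n)) →₀ ℕ}
    (hdeg : d.degree ≤ n) (hmeet : ∃ a ∈ I, d a ≠ 0) :
    Finsupp.weight (fun e : Fin (2 * n) × Fin (2 * n) => if e ∈ I then 0 else 1) d < n := by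
  classical
  obtain ⟨a, haI, hda⟩ := hmeet
  rw [Finsupp.degree_apply] at hdeg
  rw [Finsupp.weight_apply, Finsupp.sum]
  have ha : a ∈ d.support := Finsupp.mem_support_iff.2 hda
  have hsplit : ∑ x ∈ d.support, d x • (if x ∈ I then 0 else 1) + d a ≤ ∑ x ∈ d.support, d x := by
    rw [← Finset.add_sum_erase _ _ ha, ← Finset.add_sum_erase _ _ ha, if_pos haI, smul_zero, zero_add]
    have : ∑ x ∈ d.support.erase a, d x • (if x ∈ I then 0 else 1) ≤ ∑ x ∈ d.support.erase a, d x := by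
      refine Finset.sum_le_sum fun x _ => ?_
      split_ifs <;> simp
    omega
  have hda1 : 1 ≤ d a := Nat.one_le_iff_ne_zero.2 hda
  omega

/-- ★★ **POWER SUMS LED BY A NEST-FREE MATCHING ARE NOT CERTIFICATES.**  For every `c`, eventually in `n`: let `I` be a set
of short arcs (`(j − i)³ ≤ n²`), `M₀` a nest-free perfect matching avoiding `I`, `c₀ ≠ 0`, and `q` a nonnegative polynomial
all of whose monomials have degree `≤ n` and use an arc of `I`; then `h = (c₀·x^{M₀} + q)^D` satisfies
`2^((log₂ n + c)^c) < L₊(NN_n · h) + L₊(h)` for EVERY `D`. [cite: HrubesYehudayoff2021, §6 Problem 2] -/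
theorem powerSum_not_certificate_qp (c : ℕ) : ∃ n₀ : ℕ, ∀ n : ℕ, n₀ ≤ n →
    ∀ I : Finset (Fin (2 * n) × Fin (2 * n)), (∀ e ∈ I, ((e.2 : ℕ) - (e.1 : ℕ)) ^ 3 ≤ n ^ 2) →
    ∀ M₀ : Fin (2 * n) → Fin (2 * n), M₀ ∈ nestFreeMatchings (2 * n) → (∀ j ∈ openers M₀, (j, M₀ j) ∉ I) →
    ∀ c₀ : ℝ≥0, c₀ ≠ 0 → ∀ q : MvPolynomial (Fin (2 * n) × Fin (2 * n)) ℝ≥0,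
      (∀ d ∈ q.support, d.degree ≤ n ∧ ∃ a ∈ I, d a ≠ 0) → ∀ D : ℕ,
      2 ^ ((Nat.log 2 n + c) ^ c) <
        complexity (nestFreeMatchingPoly n ℝ≥0 * (C c₀ * arcMonomial ℝ≥0 M₀ + q) ^ D) +
          complexity ((C c₀ * arcMonomial ℝ≥0 M₀ + q) ^ D) := by
  obtain ⟨n₀, hn₀⟩ := shortGeneric_not_certificate_qp c
  refine ⟨n₀, fun n hn I hI M₀ hM₀ hM₀I c₀ hc₀ q hq D => ?_⟩
  classical
  set w : Fin (2 * n) × Fin (2 * n) → ℕ := fun e => if e ∈ I then 0 else 1 with hw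
  have hPM := nestFreeMatchings_subset_perfectMatchings hM₀
  have hwM : Finsupp.weight w (arcExponent M₀) = n := (weight_eq_iff I hPM).2 hM₀I
  have hmon : C c₀ * arcMonomial ℝ≥0 M₀ = monomial (arcExponent M₀) c₀ := by
    rw [arcMonomial_eq_monomial, C_mul_monomial, mul_one]
  have htop1 : topComponent w (C c₀ * arcMonomial ℝ≥0 M₀ + q) = monomial (arcExponent M₀) c₀ := by
    rw [hmon]
    refine topComponent_add_eq_left_of_lt w (W := n) ?_ (isWeightedHomogeneous_monomial w _ _ hwM) ?_
    · rw [Ne, monomial_eq_zero]; exact hc₀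
    · intro d hd
      obtain ⟨hdeg, hmeet⟩ := hq d hd
      exact weight_compl_lt_of_meets hdeg hmeet
  have htop : topComponent w ((C c₀ * arcMonomial ℝ≥0 M₀ + q) ^ D) = monomial (D • arcExponent M₀) (c₀ ^ D) := by
    have hpow : ∀ N : ℕ, topComponent w ((C c₀ * arcMonomial ℝ≥0 M₀ + q) ^ N) =
        topComponent w (C c₀ * arcMonomial ℝ≥0 M₀ + q) ^ N := by
      intro N
      induction N with
      | zero => rw [pow_zero, pow_zero, ← C_1,
          Summit.ValiantsHypothesis.ValiantsHypothesis.Theorems.ZeroOneTransfer.Negative.topComponent_C]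
      | succ N ih => rw [pow_succ, pow_succ, topComponent_mul, ih]
    rw [hpow D, htop1, monomial_pow]
  exact hn₀ n hn I hI _ _ _ (pow_ne_zero D hc₀) htop

end Summit.ValiantsHypothesis.ValiantsHypothesis.Theorems.FifoMatching.NNDivisionHard.ShortArcGeneric

end
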